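import Summits.AnomalousDissipation.AnomalousDissipation.Theses.NeutralTaylorWaves

/-!
# Two-scale vocabulary and kernel-checked composition of the line `windfibred`
# (crux `NeutralTaylorWaves.TaylorWaveQuasiSteady`, stmt-AnomalousDissipation-16293)

Definitions-only support file (plus the sorry-free, CONDITIONAL composition) for the line
`Cruxes/TaylorWaveQuasiSteady/Lines/windfibred.lean` (not importable), so that the line's REGISTERED STUBS —
landed one by one as `--supports stmt-AnomalousDissipation-16293` files under `Theorems/` — and the lead's
skeleton speak about the SAME declarations.

The crux (`Theses.NeutralTaylorWaves.TaylorWaveQuasiSteady`): ONE smooth divergence-free mean-zero force `f`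
on `T³`, `ν_n → 0⁺`, `E`, `ε₀ > 0`; `∀ K ∃ C_K ∀ n`: smooth divergence-free mean-zero `w`, smooth `q`, drift
`|c| ≤ C_K` with `∫‖w‖² ≤ E`, `|ν_n‖∇w‖₂² − ε₀| ≤ C_K√ν_n`, `‖(w·∇)w − ν_nΔw + ∇q − c∂₂w − f‖₂² ≤ C_K ν_n^K`.

The line transfers the crux to the PROFILE LEVEL on `T⁴ = T³ × T¹` (slow point `x`, fast phase `θ`): a profile
`P : T⁴ → ℝ³` is evaluated on the fast phase `θ_n(x) = (n+1)S(x)`, `S = j·x + G(x)` with an integer frequency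
vector `j : Fin 3 → ℤ` and a smooth periodic `G`; `ε_n = 1/(n+1)` is the wavelength (Taylor microscale) and
`ν_n = ε_n²` the viscosity.  Chain rule: `∂ᵢ[P ∘ e_n] = (∂ᵢP + ε⁻¹ kᵢ ∂_θP) ∘ e_n`, `k = ∇S = ∇G + j`, whence the
two-scale operators `D^ε_i = ∂ᵢ + ε⁻¹kᵢ∂_θ` below and the profile residual `tsResidual`, whose evaluation on the
fast phase is the steady residual of `w = P ∘ e_n`.

Contents:
* `epsN`, `nuN`, `slow`, `fastPhase`, `phaseMap` (`e_n`), `phaseGrad` (`k`), `tsDeriv` (`D^ε_i`), `tsDiv`,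
  `tsConvect`, `tsLaplacian`, `tsGrad`, `tsResidual`, `dissDensity` (`|k|²‖∂_θP‖²`) — verbatim the vocabulary of
  `Lines/windfibred.lean` (namespace moved from `…Cruxes.TaylorWaveQuasiSteady.Windfibred` to
  `…Theorems.TaylorWaveQuasiSteady`);
* elementary facts (`epsN_pos`, `nuN_pos`, `sqrt_nuN`, `tendsto_epsN`, `tendsto_nuN`) used by the composition;
* `TaylorWaveQuasiSteady_of` — the composition: the three registered stub STATEMENTS of the line
  (`stub_profilesW`, `stub_dissipationLawW`, `stub_residualTransferW`, taken as hypotheses, verbatim) imply the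
  crux BY NAME (pure logic: `ν := nuN`, constants `max C₂ (C₁ + C_K)`, LOUD by the triangle inequality through
  `∫ dissDensity` with `√ν_n = ε_n`); `line_glue` — the same, curried (the registered sub-goal through which this
  file lands `--supports`).

Nothing is asserted unconditionally here except definitional rewrites and limits of `1/(n+1)`.
References: the line card `Cruxes/TaylorWaveQuasiSteady/Lines/windfibred.md` and `STRATEGY-CENSUS.md`;
Lifschitz–Hameiri, Phys. Fluids A 3 (1991) (short-wave cocycle); Cheverry–Guès–Métivier, Ann. Sci. ENS 36 (2003)
and Cheverry, Bull. SMF 134 (2006) (monophase BKW profiles `U(t,x,φ/ε)`, two-scale operators `∂ₓ + ε⁻¹∇φ ∂_θ`).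
-/

-- `Summit.<Summit>.<Problem>` is the tree's mandated summit-side namespace (CONVENTIONS §2); for this
-- single-conjunct summit the two coincide, so the duplicate is deliberate.
set_option linter.dupNamespace false

noncomputable section

open scoped BigOperators Topology InnerProductSpace
open Filter MeasureTheory

namespace Summit.AnomalousDissipation.AnomalousDissipation.Theorems.TaylorWaveQuasiSteady

/-! ## §1 Two-scale vocabulary (general integer phase vector, drift axis `x₂`) -/

/-- `ε_n = 1/(n+1)`: the small parameter (wavelength = Taylor microscale `√ν_n`) at level `n`. [folklore] -/
def epsN (n : ℕ) : ℝ := 1 / ((n : ℝ) + 1)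

/-- `ν_n = ε_n²`: the viscosity at level `n` (so that `ν_n Δ` is `O(1)` on the fast phase). [folklore] -/
def nuN (n : ℕ) : ℝ := epsN n ^ 2

/-- The slow point of a two-scale point `y = (x, θ) ∈ T⁴`: forget the fast phase (last coordinate). [folklore] -/
def slow (y : UnitAddTorus (Fin 4)) : UnitAddTorus (Fin 3) := fun i => y i.castSucc

/-- The fast phase at level `n`: `θ_n(x) = ∑ᵢ ((n+1) jᵢ) • xᵢ + ↑((n+1) G x) ∈ ℝ/ℤ` (`= (n+1)S(x) mod 1`,
`S = j·x + G`), well defined on `T³` because `(n+1) jᵢ ∈ ℤ`. [folklore] -/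
def fastPhase (j : Fin 3 → ℤ) (G : UnitAddTorus (Fin 3) → ℝ) (n : ℕ) (x : UnitAddTorus (Fin 3)) : UnitAddCircle :=
  (∑ i : Fin 3, (((n : ℤ) + 1) * j i) • x i) + ((((n : ℝ) + 1) * G x : ℝ) : UnitAddCircle)

/-- The two-scale evaluation map `e_n : T³ → T⁴`, `x ↦ (x, θ_n x)`. [folklore] -/
def phaseMap (j : Fin 3 → ℤ) (G : UnitAddTorus (Fin 3) → ℝ) (n : ℕ) (x : UnitAddTorus (Fin 3)) : UnitAddTorus (Fin 4) :=
  @Fin.snoc 3 (fun _ => UnitAddCircle) x (fastPhase j G n x)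

/-- Components of the phase gradient `k = ∇S = ∇G + j`. [folklore] -/
def phaseGrad (j : Fin 3 → ℤ) (G : UnitAddTorus (Fin 3) → ℝ) (i : Fin 3) (x : UnitAddTorus (Fin 3)) : ℝ :=
  Literature.Analysis.FunctionSpaces.Torus.partialDeriv i G x + (j i : ℝ)

/-- The two-scale partial derivative in the slow direction `i` at scale `ε`:
`D^ε_i Φ = ∂_{yᵢ} Φ + ε⁻¹ kᵢ(x) ∂_θ Φ` (`θ` = the last coordinate of `T⁴`). [folklore] -/
def tsDeriv {F : Type*} [NormedAddCommGroup F] [NormedSpace ℝ F] (ε : ℝ) (j : Fin 3 → ℤ)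
    (G : UnitAddTorus (Fin 3) → ℝ) (i : Fin 3) (Φ : UnitAddTorus (Fin 4) → F) (y : UnitAddTorus (Fin 4)) : F :=
  Literature.Analysis.FunctionSpaces.Torus.partialDeriv i.castSucc Φ y +
    (ε⁻¹ * phaseGrad j G i (slow y)) • Literature.Analysis.FunctionSpaces.Torus.partialDeriv (Fin.last 3) Φ y

/-- Two-scale divergence `∑ᵢ D^ε_i Pᵢ`. [folklore] -/
def tsDiv (ε : ℝ) (j : Fin 3 → ℤ) (G : UnitAddTorus (Fin 3) → ℝ) (P : UnitAddTorus (Fin 4) → EuclideanSpace ℝ (Fin 3))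
    (y : UnitAddTorus (Fin 4)) : ℝ :=
  ∑ i : Fin 3, (tsDeriv ε j G i P y) i

/-- Two-scale convective derivative `(P · D^ε) Φ = ∑ₗ Pₗ D^ε_l Φ`. [folklore] -/
def tsConvect {F : Type*} [NormedAddCommGroup F] [NormedSpace ℝ F] (ε : ℝ) (j : Fin 3 → ℤ)
    (G : UnitAddTorus (Fin 3) → ℝ) (P : UnitAddTorus (Fin 4) → EuclideanSpace ℝ (Fin 3))
    (Φ : UnitAddTorus (Fin 4) → F) (y : UnitAddTorus (Fin 4)) : F :=
  ∑ l : Fin 3, (P y) l • tsDeriv ε j G l Φ y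

/-- Two-scale Laplacian `∑ᵢ D^ε_i D^ε_i Φ` (`= |k|² ε⁻² ∂_θ² + 2ε⁻¹ k·∇∂_θ + ε⁻¹ (ΔS) ∂_θ + Δ_x`). [folklore] -/
def tsLaplacian {F : Type*} [NormedAddCommGroup F] [NormedSpace ℝ F] (ε : ℝ) (j : Fin 3 → ℤ)
    (G : UnitAddTorus (Fin 3) → ℝ) (Φ : UnitAddTorus (Fin 4) → F) (y : UnitAddTorus (Fin 4)) : F :=
  ∑ i : Fin 3, tsDeriv ε j G i (tsDeriv ε j G i Φ) y

/-- Two-scale gradient of a scalar profile, `(D^ε_i Q)ᵢ ∈ ℝ³`. [folklore] -/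
def tsGrad (ε : ℝ) (j : Fin 3 → ℤ) (G : UnitAddTorus (Fin 3) → ℝ) (Q : UnitAddTorus (Fin 4) → ℝ)
    (y : UnitAddTorus (Fin 4)) : EuclideanSpace ℝ (Fin 3) :=
  WithLp.toLp 2 fun i : Fin 3 => tsDeriv ε j G i Q y

/-- The two-scale STEADY residual with viscosity `ε²`, drift `c` along `x₂` and force `f(x)`:
`(P·D^ε)P − ε² ∑ᵢ(D^ε_i)²P + D^εQ − c D^ε_2 P − f ∘ slow` — the profile whose evaluation on the fast phase is
`w·∇w − ν_nΔw + ∇q − c∂₂w − f` for `w = P ∘ e_n`, `q = Q ∘ e_n`, `ε = ε_n`. [folklore] -/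
def tsResidual (ε : ℝ) (j : Fin 3 → ℤ) (G : UnitAddTorus (Fin 3) → ℝ)
    (f : UnitAddTorus (Fin 3) → EuclideanSpace ℝ (Fin 3)) (P : UnitAddTorus (Fin 4) → EuclideanSpace ℝ (Fin 3))
    (Q : UnitAddTorus (Fin 4) → ℝ) (c : ℝ) (y : UnitAddTorus (Fin 4)) : EuclideanSpace ℝ (Fin 3) :=
  tsConvect ε j G P P y - ε ^ 2 • tsLaplacian ε j G P y + tsGrad ε j G Q y - c • tsDeriv ε j G 2 P y - f (slow y)

/-- The fast-phase DISSIPATION DENSITY `|k(x)|² ‖∂_θ P(x,θ)‖²` of a profile: its `T⁴`-mean is the `ν → 0` limit of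
`ν‖∇w‖₂²` for the evaluated Taylor-scale family (`stub_dissipationLawW`). [folklore] -/
def dissDensity (j : Fin 3 → ℤ) (G : UnitAddTorus (Fin 3) → ℝ) (P : UnitAddTorus (Fin 4) → EuclideanSpace ℝ (Fin 3))
    (y : UnitAddTorus (Fin 4)) : ℝ :=
  ∑ i : Fin 3, phaseGrad j G i (slow y) ^ 2 *
    ‖Literature.Analysis.FunctionSpaces.Torus.partialDeriv (Fin.last 3) P y‖ ^ 2

/-! ## §2 Elementary rewrites -/

/-- `ε_n > 0`. [folklore] -/
theorem epsN_pos (n : ℕ) : 0 < epsN n := by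
  unfold epsN
  positivity

/-- `ν_n > 0`. [folklore] -/
theorem nuN_pos (n : ℕ) : 0 < nuN n := by
  unfold nuN
  exact pow_pos (epsN_pos n) 2

/-- `√ν_n = ε_n`. [folklore] -/
theorem sqrt_nuN (n : ℕ) : Real.sqrt (nuN n) = epsN n := by
  unfold nuN
  exact Real.sqrt_sq (epsN_pos n).le

/-- `ε_n → 0`. [folklore] -/
theorem tendsto_epsN : Tendsto epsN atTop (𝓝 0) :=
  tendsto_one_div_add_atTop_nhds_zero_nat (𝕜 := ℝ)

/-- `ν_n → 0`. [folklore] -/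
theorem tendsto_nuN : Tendsto nuN atTop (𝓝 0) := by
  have h := (tendsto_epsN).pow 2
  rw [zero_pow two_ne_zero] at h
  exact h

/-! ## §3 The composition: the three registered stubs imply the crux by name -/

/-- **Composition** (kernel-checked, no `sorry`): the three registered stub statements of the line `windfibred`
(`stub_profilesW` = all-orders general-phase profile construction, `stub_dissipationLawW` = Taylor dissipation law,
`stub_residualTransferW` = two-scale evaluation / residual transfer; verbatim, as hypotheses) imply the crux
`…Theses.NeutralTaylorWaves.TaylorWaveQuasiSteady` BY NAME.  `ν_n := nuN n = 1/(n+1)²`; force, energy and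
dissipation levels from stub 1; for each `K` the constants `C_K` (stub 1), `C₁` (stub 2 with `M := C_K`, same
`j, i₀, G`), `C₂` (stub 3) combine as `max C₂ (C₁ + C_K)`; the field, pressure and drift at level `n` are those
returned by stub 3 on the level-`n` profiles of stub 1; LOUD is the triangle inequality through `∫ dissDensity` with
`√ν_n = ε_n`. [folklore] -/
theorem TaylorWaveQuasiSteady_of
    (H1 : ∃ (j : Fin 3 → ℤ) (i₀ : Fin 3) (G : UnitAddTorus (Fin 3) → ℝ) (f : UnitAddTorus (Fin 3) → EuclideanSpace ℝ (Fin 3)) (E ε₀ : ℝ), j i₀ ≠ 0 ∧ Literature.Analysis.FunctionSpaces.Torus.IsSmooth G ∧ (∀ x, Literature.Analysis.FunctionSpaces.Torus.partialDeriv i₀ G x = 0) ∧ Literature.Analysis.FunctionSpaces.Torus.IsSmooth f ∧ Literature.Analysis.FunctionSpaces.Torus.IsDivFree f ∧ Literature.Analysis.FunctionSpaces.Torus.HasZeroMean f ∧ 0 < ε₀ ∧ ∀ K : ℕ, ∃ C : ℝ, ∀ n : ℕ, ∃ (P : UnitAddTorus (Fin 4) → EuclideanSpace ℝ (Fin 3))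 (Q : UnitAddTorus (Fin 4) → ℝ) (c : ℝ), Literature.Analysis.FunctionSpaces.Torus.IsSmooth P ∧ Literature.Analysis.FunctionSpaces.Torus.IsSmooth Q ∧ |c| ≤ C ∧ (∀ y, ‖P y‖ ^ 2 ≤ E) ∧ (∀ (i : Fin 3) y, ‖Literature.Analysis.FunctionSpaces.Torus.partialDeriv i.castSucc P y‖ ≤ C) ∧ (∀ y, ‖Literature.Analysis.FunctionSpaces.Torus.partialDeriv (Fin.last 3) P y‖ ≤ C) ∧ (∀ (i : Fin 3) y, ‖Literature.Analysis.FunctionSpaces.Torus.partialDeriv i.castSucc (Literature.Analysis.FunctionSpaces.Torus.partialDeriv (Fin.last 3) P) y‖ ≤ C) ∧ |(∫ y, dissDensity j G P y) - ε₀| ≤ C * epsN n ∧ (∫ x, P (phaseMap j G n x)) 0 = 0 ∧ (∫ x, P (phaseMap j G n x)) 1 = 0 ∧ (∀ y, tsDiv (epsN n) j G P y = 0) ∧ (∀ y, ‖tsResidual (epsN n) j G f P Q c y‖ ^ 2 ≤ C * nuN n ^ K))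
    (H2 : ∀ (j : Fin 3 → ℤ) (i₀ : Fin 3) (G : UnitAddTorus (Fin 3) → ℝ) (M : ℝ), j i₀ ≠ 0 → Literature.Analysis.FunctionSpaces.Torus.IsSmooth G → (∀ x, Literature.Analysis.FunctionSpaces.Torus.partialDeriv i₀ G x = 0) → ∃ C₁ : ℝ, ∀ (n : ℕ) (P : UnitAddTorus (Fin 4) → EuclideanSpace ℝ (Fin 3)), Literature.Analysis.FunctionSpaces.Torus.IsSmooth P → (∀ (i : Fin 3) y, ‖Literature.Analysis.FunctionSpaces.Torus.partialDeriv i.castSucc P y‖ ≤ M) → (∀ y, ‖Literature.Analysis.FunctionSpaces.Torus.partialDeriv (Fin.last 3) P y‖ ≤ M) → (∀ (i : Fin 3) y, ‖Literature.Analysis.FunctionSpaces.Torus.partialDeriv i.castSucc (Literature.Analysis.FunctionSpaces.Torus.partialDeriv (Fin.last 3) P) y‖ ≤ M) → |nuN n * Literature.Analysis.FunctionSpaces.Torus.gradNormSq (fun x => P (phaseMap j G n x)) - ∫ y, dissDensity j G P y| ≤ C₁ * epsN n)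
    (H3 : ∀ (j : Fin 3 → ℤ) (G : UnitAddTorus (Fin 3) → ℝ) (f : UnitAddTorus (Fin 3) → EuclideanSpace ℝ (Fin 3)) (E C : ℝ) (K : ℕ), Literature.Analysis.FunctionSpaces.Torus.IsSmooth G → ∃ C₂ : ℝ, ∀ (n : ℕ) (P : UnitAddTorus (Fin 4) → EuclideanSpace ℝ (Fin 3)) (Q : UnitAddTorus (Fin 4) → ℝ) (c : ℝ), Literature.Analysis.FunctionSpaces.Torus.IsSmooth P → Literature.Analysis.FunctionSpaces.Torus.IsSmooth Q → |c| ≤ C → (∀ y, ‖P y‖ ^ 2 ≤ E) → (∫ x, P (phaseMap j G n x)) 0 = 0 → (∫ x, P (phaseMap j G n x)) 1 = 0 → (∀ y, tsDiv (epsN n) j G P y = 0) → (∀ y, ‖tsResidual (epsN n) j G f P Q c y‖ ^ 2 ≤ C * nuN n ^ K) → ∃ (w : UnitAddTorus (Fin 3) → EuclideanSpace ℝ (Fin 3)) (q : UnitAddTorus (Fin 3) → ℝ) (c' : ℝ), Literature.Analysis.FunctionSpaces.Torus.IsSmooth w ∧ Literature.Analysis.FunctionSpaces.Torus.IsSmooth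 q ∧ Literature.Analysis.FunctionSpaces.Torus.IsDivFree w ∧ Literature.Analysis.FunctionSpaces.Torus.HasZeroMean w ∧ |c'| ≤ C₂ ∧ MeasureTheory.integral MeasureTheory.volume (fun x => ‖w x‖ ^ 2) ≤ E ∧ Literature.Analysis.FunctionSpaces.Torus.gradNormSq w = Literature.Analysis.FunctionSpaces.Torus.gradNormSq (fun x => P (phaseMap j G n x)) ∧ MeasureTheory.integral MeasureTheory.volume (fun x => ‖Literature.Analysis.FunctionSpaces.Torus.convect w w x - (nuN n) • Literature.Analysis.FunctionSpaces.Torus.laplacian w x + Literature.Analysis.FunctionSpaces.Torus.gradient q x - c' • Literature.Analysis.FunctionSpaces.Torus.partialDeriv (2 : Fin 3) w x - f x‖ ^ 2) ≤ C₂ * (nuN n) ^ K) :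
    Summit.AnomalousDissipation.AnomalousDissipation.Theses.NeutralTaylorWaves.TaylorWaveQuasiSteady := by
  obtain ⟨j, i₀, G, f, E, ε₀, hj, hG, hG0, hf, hfdiv, hfmean, hε₀, hK⟩ := H1
  refine ⟨f, hf, hfdiv, hfmean, nuN, E, ε₀, nuN_pos, tendsto_nuN, hε₀, fun K => ?_⟩
  obtain ⟨C, hC⟩ := hK K
  obtain ⟨C₁, hC₁⟩ := H2 j i₀ G C hj hG hG0
  obtain ⟨C₂, hC₂⟩ := H3 j G f E C K hG
  refine ⟨max C₂ (C₁ + C), fun n => ?_⟩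
  obtain ⟨P, Q, c, hP, hQ, hc, hPE, hd1, hdθ, hd2, hdiss, hm0, hm1, hdiv, hres⟩ := hC n
  obtain ⟨w, q, c', hw, hq, hwdiv, hwmean, hc', hwE, hgrad, hwres⟩ :=
    hC₂ n P Q c hP hQ hc hPE hm0 hm1 hdiv hres
  have hB := hC₁ n P hP hd1 hdθ hd2
  refine ⟨w, q, c', hw, hq, hwdiv, hwmean, hc'.trans (le_max_left _ _), hwE, ?_, ?_⟩
  · -- LOUD: |ν_n ‖∇w‖² − ε₀| ≤ |ν_n ‖∇(P∘e_n)‖² − ∫ dissDensity| + |∫ dissDensity − ε₀| ≤ (C₁ + C) ε_n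
    rw [hgrad, sqrt_nuN]
    have htri : |nuN n * Literature.Analysis.FunctionSpaces.Torus.gradNormSq (fun x => P (phaseMap j G n x)) - ε₀| ≤
        C₁ * epsN n + C * epsN n :=
      (abs_sub_le _ _ _).trans (add_le_add hB hdiss)
    calc |nuN n * Literature.Analysis.FunctionSpaces.Torus.gradNormSq (fun x => P (phaseMap j G n x)) - ε₀|
        ≤ (C₁ + C) * epsN n := by rw [add_mul]; exact htri
      _ ≤ max C₂ (C₁ + C) * epsN n :=
          mul_le_mul_of_nonneg_right (le_max_right _ _) (epsN_pos n).le
  · -- QUASI-STEADY: the residual bound of stub 3 with the larger constant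
    exact hwres.trans (mul_le_mul_of_nonneg_right (le_max_left _ _) (pow_nonneg (nuN_pos n).le K))

/-- **Line glue** (the registered sub-goal `line_glue` of stmt-AnomalousDissipation-16293): the curried form of
`TaylorWaveQuasiSteady_of` — `stub_profilesW → stub_dissipationLawW → stub_residualTransferW → TaylorWaveQuasiSteady`,
each stub statement verbatim. [folklore] -/
theorem line_glue : (∃ (j : Fin 3 → ℤ) (i₀ : Fin 3) (G : UnitAddTorus (Fin 3) → ℝ) (f : UnitAddTorus (Fin 3) → EuclideanSpace ℝ (Fin 3)) (E ε₀ : ℝ), j i₀ ≠ 0 ∧ Literature.Analysis.FunctionSpaces.Torus.IsSmooth G ∧ (∀ x, Literature.Analysis.FunctionSpaces.Torus.partialDeriv i₀ G x = 0) ∧ Literature.Analysis.FunctionSpaces.Torus.IsSmooth f ∧ Literature.Analysis.FunctionSpaces.Torus.IsDivFree f ∧ Literature.Analysis.FunctionSpaces.Torus.HasZeroMean f ∧ 0 < ε₀ ∧ ∀ K : ℕ, ∃ C : ℝ, ∀ n : ℕ, ∃ (P : UnitAddTorus (Fin 4) → EuclideanSpace ℝ (Fin 3)) (Q : UnitAddTorus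 (Fin 4) → ℝ) (c : ℝ), Literature.Analysis.FunctionSpaces.Torus.IsSmooth P ∧ Literature.Analysis.FunctionSpaces.Torus.IsSmooth Q ∧ |c| ≤ C ∧ (∀ y, ‖P y‖ ^ 2 ≤ E) ∧ (∀ (i : Fin 3) y, ‖Literature.Analysis.FunctionSpaces.Torus.partialDeriv i.castSucc P y‖ ≤ C) ∧ (∀ y, ‖Literature.Analysis.FunctionSpaces.Torus.partialDeriv (Fin.last 3) P y‖ ≤ C) ∧ (∀ (i : Fin 3) y, ‖Literature.Analysis.FunctionSpaces.Torus.partialDeriv i.castSucc (Literature.Analysis.FunctionSpaces.Torus.partialDeriv (Fin.last 3) P) y‖ ≤ C) ∧ |(∫ y, dissDensity j G P y) - ε₀| ≤ C * epsN n ∧ (∫ x, P (phaseMap j G n x)) 0 = 0 ∧ (∫ x, P (phaseMap j G n x)) 1 = 0 ∧ (∀ y, tsDiv (epsN n) j G P y = 0) ∧ (∀ y, ‖tsResidual (epsN n) j G f P Q c y‖ ^ 2 ≤ C * nuN n ^ K)) → (∀ (j : Fin 3 → ℤ) (i₀ : Fin 3) (G : UnitAddTorus (Fin 3) → ℝ)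 (M : ℝ), j i₀ ≠ 0 → Literature.Analysis.FunctionSpaces.Torus.IsSmooth G → (∀ x, Literature.Analysis.FunctionSpaces.Torus.partialDeriv i₀ G x = 0) → ∃ C₁ : ℝ, ∀ (n : ℕ) (P : UnitAddTorus (Fin 4) → EuclideanSpace ℝ (Fin 3)), Literature.Analysis.FunctionSpaces.Torus.IsSmooth P → (∀ (i : Fin 3) y, ‖Literature.Analysis.FunctionSpaces.Torus.partialDeriv i.castSucc P y‖ ≤ M) → (∀ y, ‖Literature.Analysis.FunctionSpaces.Torus.partialDeriv (Fin.last 3) P y‖ ≤ M) → (∀ (i : Fin 3) y, ‖Literature.Analysis.FunctionSpaces.Torus.partialDeriv i.castSucc (Literature.Analysis.FunctionSpaces.Torus.partialDeriv (Fin.last 3) P) y‖ ≤ M) → |nuN n * Literature.Analysis.FunctionSpaces.Torus.gradNormSq (fun x => P (phaseMap j G n x)) - ∫ y, dissDensity j G P y| ≤ C₁ * epsN n) → (∀ (j : Fin 3 → ℤ) (G : UnitAddTorus (Fin 3) → ℝ) (f : UnitAddTorus (Fin 3) → EuclideanSpace ℝ (Fin 3)) (E C : ℝ) (K : ℕ),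 Literature.Analysis.FunctionSpaces.Torus.IsSmooth G → ∃ C₂ : ℝ, ∀ (n : ℕ) (P : UnitAddTorus (Fin 4) → EuclideanSpace ℝ (Fin 3)) (Q : UnitAddTorus (Fin 4) → ℝ) (c : ℝ), Literature.Analysis.FunctionSpaces.Torus.IsSmooth P → Literature.Analysis.FunctionSpaces.Torus.IsSmooth Q → |c| ≤ C → (∀ y, ‖P y‖ ^ 2 ≤ E) → (∫ x, P (phaseMap j G n x)) 0 = 0 → (∫ x, P (phaseMap j G n x)) 1 = 0 → (∀ y, tsDiv (epsN n) j G P y = 0) → (∀ y, ‖tsResidual (epsN n) j G f P Q c y‖ ^ 2 ≤ C * nuN n ^ K) → ∃ (w : UnitAddTorus (Fin 3) → EuclideanSpace ℝ (Fin 3)) (q : UnitAddTorus (Fin 3) → ℝ) (c' : ℝ), Literature.Analysis.FunctionSpaces.Torus.IsSmooth w ∧ Literature.Analysis.FunctionSpaces.Torus.IsSmooth q ∧ Literature.Analysis.FunctionSpaces.Torus.IsDivFree w ∧ Literature.Analysis.FunctionSpaces.Torus.HasZeroMean w ∧ |c'| ≤ C₂ ∧ MeasureTheory.integral MeasureTheory.volume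 (fun x => ‖w x‖ ^ 2) ≤ E ∧ Literature.Analysis.FunctionSpaces.Torus.gradNormSq w = Literature.Analysis.FunctionSpaces.Torus.gradNormSq (fun x => P (phaseMap j G n x)) ∧ MeasureTheory.integral MeasureTheory.volume (fun x => ‖Literature.Analysis.FunctionSpaces.Torus.convect w w x - (nuN n) • Literature.Analysis.FunctionSpaces.Torus.laplacian w x + Literature.Analysis.FunctionSpaces.Torus.gradient q x - c' • Literature.Analysis.FunctionSpaces.Torus.partialDeriv (2 : Fin 3) w x - f x‖ ^ 2) ≤ C₂ * (nuN n) ^ K) → Summit.AnomalousDissipation.AnomalousDissipation.Theses.NeutralTaylorWaves.TaylorWaveQuasiSteady :=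
  TaylorWaveQuasiSteady_of

end Summit.AnomalousDissipation.AnomalousDissipation.Theorems.TaylorWaveQuasiSteady

end
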